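import Summits.QuantumFields.BalabanUV.T4Continuum.Support.NE7EnergyRateWPrep
import Summits.QuantumFields.BalabanUV.T4Continuum.Support.NE7PairDecompNL0Sup
import Summits.QuantumFields.BalabanUV.T4Continuum.Support.NE7PairCovGradRate40
import Summits.QuantumFields.BalabanUV.T4Continuum.Support.NE3AveragedGradientRadius
import HarnessLib

/-!
# NE7EnergyGradRateWSU2Log — supplier stub (S-g′)∕(S-h) of the NE7 crux (ROAD-G108 §3–§4): T-E_w♯ TOGETHER WITH THE COVARIANT-GRADIENT RATE (Gᶜ_w) FOR SU(2), d = 4, L = 2, FROM THE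
# LOG-TOLERANT (10)-TYPE LETTERS `‖∇_U F‖ ≤ c·(1+k)·(spacing)³` OF THE TWO MINIMISERS — gen 108's `NE7EnergyGradRateWSU2.ne3EnergyGradRateWSup_SU2` VERBATIM with the flux-gradient
# hypotheses weakened by the factor `(1+k)` (the Calderón–Zygmund∕junction logarithm the planned supplier (S-h) carries), the conclusion UNCHANGED (`Λ_G·θ^{38k}`, k-free `Λ_G`)

Cell `pub-balaban`, rung (B)+1 sub-cell t4, lineage `b2b-balaban-t4-ne7-p1`, generation 108 (CRUX PROVER NE7 #1 = OWNER of BINDER row NE7).  Memo `t4/b2b-balaban-t4-ne7-p1-g108/ROAD-G108.md` §4.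
HOW.  At level `k = j+1` both letters are dominated by `c′ := c·(2+k)`; gen 105's energy-convexity proof and gen 108's radii VERBATIM at `c′`; the one-level theorem at target exponent
`40` (`NE7PairCovGradRate40.covGrad_rate_le`); `Λ₂⁰(c′) ≤ (2+k)Λ₂⁰(c)`, so the only `c`-dependent constant `32K_G·l₀(c′)²·γ·D` is `≤ (2+k)²·32K_G·l₀(c)²·γ·D`, and `(2+k)²θ^{40k} ≤
4D²θ^{38k}` (`NE7CovGradBootstrapAlgebra.sq_two_add_rate`); the other two constants lose `θ^{2k} ≤ 1`.  RESULT `Λ_G = 128K_Gl₀²γD³ + 2²⁷C_Sε²K_G³γ³D³ + 2(K_Gc_Nγ⁶D + 2c_Nγ⁶)`.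
WHAT ([folklore]; 0 def, 0 sorry).  **`ne3EnergyGradRateWSup_SU2_log`**: as `ne3EnergyGradRateWSup_SU2` with the hypotheses `‖covGrad U_A (flux U_A) x κ π‖ ≤ c(1+k)∕(2^k)³`,
`‖covGrad U_B (flux U_B) x κ π‖ ≤ c(1+(k+1))∕(2^{k+1})³`.
HONEST FRAMING (page 1): composition of landed kernel theorems of rows NE3 and NE7 and of [B7]∕[B8]∕[B11] AS TYPED in the tree; the log-tolerant flux-gradient letters are HYPOTHESES
(WEAKER than the TYPE of [Balaban1985Variational] Thm 1 (10); asserted for no minimiser — NOT a theorem of the tree; the planned supplier (S-h) targets exactly this shape); nothing of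
Bałaban's asserted as an axiom; constants existential; SU(2), `L = 2`, finite 4-torus only; NOT NE3∕NE7 as spine nodes; spine count = dagwriter∕referees' call; NOT infinite volume,
NOT mass gap, NOT BetaPertH, NOT Clay (continuum YM on T⁴ ⇐ BetaPertH ∧ nine spine estimates).
-/

set_option autoImplicit false

open scoped BigOperators Matrix Matrix.Norms.L2Operator
open NormedSpace Finset Set

namespace Summit.QuantumFields.BalabanUV.T4Continuum.NE7EnergyGradRateWSU2Log

open Literature.MathematicalPhysics.QuantumFieldTheory.Balaban1983to89
open B7Prop1Explicit B7Prop2Explicit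
open T4AveragingDeficitWall (IsUnitaryCfg IsSkewDir SmallField fineAction vary curl curlSq dirSq)
open T4AveragingDeficitWallBoundary (IsPeriodicCfg periodBox)
open T4ConvexResponse (taylor_lower)
open AveragingDeficitPeriodicCounting (IsPeriodicDir)
open AveragingDeficitDerivWallProof (wallConst wallConst_nonneg)
open AveragingDeficitCoreAxial (coreC_nonneg)
open AveragingDeficitDualResidual (dualC2 dualC1)
open AveragingDeficitChartCalculus (cavg)
open AveragingDeficitTwoLevelPrep (prop1Radius smallField_cavg)
open AveragingDeficitFermat (isPeriodicCfg_cavg)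
open AveragingDeficitMultiLevelPrep (LevelSmall tower)
open AveragingDeficitMultiLevelBridge (cavg_eq_rescale_bavg)
open MinimalActionLevels (perWin levelAction avgIter_rescale_bavg stepWt_pos)
open MinimalActionSandwich (IsMinimiser admissible)
open MinimalActionRate (sfClass Regular)
open NE3HessForm (dAction hess segment_derivData)
open NE3SlicePoincareBudgetLine (CPLine)
open NE3ClassRadiusFamily (CPLine_nonneg_d4_L2)
open NE3EnergyShapes (IsUnitarySite IsPeriodicSite residualScale residualScale_nonneg dualC1_nonneg dualC2_nonneg)
open NE3EnergyWeightedShapes (energyNormW energyNormW_nonneg)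
open NE3EnergyWeightedSupShape (NE3EnergyRateWSup)
open NE3WeightedCoercivityTransfer (energyNormW_sq)
open NE3ProductPathBounds (energyNormW_sub_le)
open NE3EnergyChartLeaves (isUnitaryCfg_cavg_of_regular)
open NE3RightInverseSupLetters (frameC)
open NE3AxialGaugeLadder (smallField_gaugeAct)
open NE7MeanZeroGaugeSliceW (energyBlockLandauW)
open NE7EnergyBlockLandauClassPoincare (classSlicePoincare_energyBlockLandau_SU2)
open NE7ConvOneStepSU2 (levelSmall_all_d4_L2)
open NE7ConvOneStepWeighted (curlSq_ge_weighted hess_vary_ge_weighted)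
open NE7SegmentPlaquetteRadius (smallField_vary_segment_class)
open NE7OneStepLetters (abs_dAction_le_radius_mul)
open NE7ExactCurrent (dAction_add)
open NE7EtaMinimiserGaugeCovariance (levelAction_gaugeAct)
open NE7RepWGaugeOfRoutePi (exp_term_le_of_currency)
open NE7HintUnconditionalSU2 (line_of_small)
open NE7PairDecompNL0Sup (decomp_of_nl0_pair_sup)
open NE7PairCovGradRate40 (covGrad_rate_le)
open NE7EtaRatesD4 (energy_budget_of_residualScale)
open NE7CovGradBootstrapAlgebra (exists_cube_root sq_two_add_rate rate_plain)
open NE3AveragedGradientRadius (norm_plaqGrad_cavg_le_of_regularSup norm_plaqGrad_gaugeAct')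
open NE3FluxGradientDictionary (norm_Ad_hol_sub_hol_le_of_fluxGrad)
open MinimalActionRefine (RegularSup)
open BlockAverageCurrent (curConst curConst_nonneg)
open NE7EnergySliceSpikeResidual (energyNormW_spike_sq_le spike_tangent_data abs_dAction_le_of_regular_slice)
open BlockAveragePushDirGauge (gaugeDir)
open NE3CornerSpikes (spikeW)
open NE3TangentCovariantTower (framePotW)

open NE7EnergyRateWPrep

noncomputable section

/-! ## T-E_w♯ with (Gᶜ_w) for SU(2), d = 4, L = 2, from log-tolerant (10)-TYPE letters -/

set_option maxHeartbeats 800000 in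
/-- **T-E_w♯ TOGETHER WITH (Gᶜ_w), FOR SU(2), `d = 4`, `L = 2`, MODULO THE LOG-TOLERANT FLUX-GRADIENT LETTERS OF THE TWO MINIMISERS** (statement and argument in the file header).
[folklore] -/
theorem ne3EnergyGradRateWSup_SU2_log {n : Type} [Fintype n] [DecidableEq n] [Nonempty n] (hn : Fintype.card n = 2) :
    ∃ ε₀ : ℝ, 0 < ε₀ ∧ ∀ ε : ℝ, 0 < ε → ε ≤ ε₀ → ∀ b g c : ℝ, 0 ≤ b → b + 10 ^ 8 * b ^ 2 ≤ ε → 0 < g → 0 ≤ c →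
      ∀ θ : ℝ, 0 < θ → θ ^ 18 = (((2 : ℕ) : ℝ))⁻¹ →
      ∃ C s : ℝ, 0 ≤ C ∧ 0 ≤ s ∧ ∀ (N : ℕ) [NeZero N], ∃ ΛG : ℝ, 0 ≤ ΛG ∧ ∀ (dom : Set (Site 4 → Fin 4 → (Matrix n n ℂ)ˣ)),
        ∀ k : ℕ, 1 ≤ k → ∀ V ∈ dom, ∀ UA UB : Site 4 → Fin 4 → (Matrix n n ℂ)ˣ,
          IsMinimiser 4 (sfClass 4 2 N ε) 2 N k V UA → IsMinimiser 4 (sfClass 4 2 N ε) 2 N (k + 1) V UB → Regular 4 2 N b g (k + 1) UB →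
          (∀ (x : Site 4) (κ : Fin 4) (π : T4AveragingDeficitWall.Plane 4), ‖T4AveragingDeficitWall.covGrad UA (T4AveragingDeficitWall.flux UA) x κ π‖
              ≤ c * (1 + (k : ℝ)) / (((2 : ℕ) : ℝ) ^ k) ^ 3) →
          (∀ (x : Site 4) (κ : Fin 4) (π : T4AveragingDeficitWall.Plane 4), ‖T4AveragingDeficitWall.covGrad UB (T4AveragingDeficitWall.flux UB) x κ π‖
              ≤ c * (1 + ((k + 1 : ℕ) : ℝ)) / (((2 : ℕ) : ℝ) ^ (k + 1)) ^ 3) →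
          ∃ (u : Site 4 → (Matrix n n ℂ)ˣ) (Z : Site 4 → Fin 4 → Matrix n n ℂ),
            IsUnitarySite u ∧ IsPeriodicSite u ((N * 2 ^ k : ℕ) : ℤ) ∧
            IsSkewDir Z ∧ IsPeriodicDir Z ((N * 2 ^ k : ℕ) : ℤ) ∧
            gaugeAct u UA = vary (rescale 2 (bavg 2 UB)) Z 1 ∧
            energyNormW 2 k (rescale 2 (bavg 2 UB)) Z (periodBox (N * 2 ^ k)) ≤ C * residualScale 4 2 N b g k ∧
            (∀ (x : Site 4) (κ : Fin 4), ‖Z x κ‖ ≤ s * ((((2 : ℕ) : ℝ))⁻¹) ^ k) ∧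
            (∀ (κ : Fin 4) (x : Site 4) (μ : Fin 4),
              ‖T4AveragingDeficitWall.Ad (rescale 2 (bavg 2 UB) (x + e κ) μ) (Z (x + e μ) κ) - Z x κ‖ ≤ ΛG * θ ^ (38 * k)) := by
  obtain ⟨ε₂, hε₂, CS, hCS, νc, hνc, κc, hκc, cN, hcN, hdec⟩ := decomp_of_nl0_pair_sup (n := n)
  obtain ⟨KG, hKG, εG, hεG, hcov⟩ := covGrad_rate_le (n := n)
  -- the k-free coercivity budget of gen 104 (`line_of_small`), Poincaré constant `CP = 8·CPLine + 1`
  obtain ⟨CP, hCP⟩ : ∃ CP : ℝ, CP = 8 * CPLine 4 2 2 (1 / 10 ^ 17) (1 / 10 ^ 53) + 1 := ⟨_, rfl⟩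
  have hCP1 : 1 ≤ CP := by rw [hCP]; have := CPLine_nonneg_d4_L2; linarith
  have hCP0 : 0 ≤ CP := by linarith
  obtain ⟨Q, hQ⟩ : ∃ Q : ℝ, Q = 2 * (1 + CP) := ⟨_, rfl⟩
  have hQ4 : 4 ≤ Q := by rw [hQ]; linarith
  have hQ0 : 0 < Q := by linarith
  obtain ⟨cL, hcL⟩ : ∃ cL : ℝ, cL = 2 * κc + νc ^ 2 + 2304 * (CS ^ 2 * Real.exp (2 * CS)) + 112 * (1 + 7 * CS ^ 2) + 1 := ⟨_, rfl⟩
  have hcL0 : 0 < cL := by rw [hcL]; positivity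
  obtain ⟨ε₃, hε₃⟩ : ∃ ε₃ : ℝ, ε₃ = (1 / 2) / Q / 4 / cL := ⟨_, rfl⟩
  have hε₃0 : 0 < ε₃ := by rw [hε₃]; positivity
  have hcard : (0 : ℝ) < 1000000000000000000000 * (Fintype.card n : ℝ) := by rw [hn]; norm_num
  -- the (Gᶜ_w) regime: `ε ≤ ε_G` (curved letter), `C_S ε ≤ 1∕48`, `2¹⁵·5²·8²·2²·ε ≤ 1` (the (Rb) line of `NE3AveragedGradientRadius`)
  have h48 : (0 : ℝ) < 1 / (48 * CS) := by positivity
  refine ⟨min (min ε₂ (min (1 / 10 ^ 53) (min (1 / (1000000000000000000000 * (Fintype.card n : ℝ))) (min ε₃ 1)))) (min εG (min (1 / (48 * CS)) (1 / 10 ^ 9))),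
    lt_min (lt_min hε₂ (lt_min (by norm_num) (lt_min (by positivity) (lt_min hε₃0 one_pos)))) (lt_min hεG (lt_min h48 (by norm_num))), ?_⟩
  intro ε hε hεle0 b g c hb hbq hg hc θ hθ hθ18
  have hεle := hεle0.trans (min_le_left _ _)
  have hεεG : ε ≤ εG := hεle0.trans ((min_le_right _ _).trans (min_le_left _ _))
  have hε48 : CS * ε ≤ 1 / 48 := by
    have h := hεle0.trans ((min_le_right _ _).trans ((min_le_right _ _).trans (min_le_left _ _)))
    rw [le_div_iff₀ (by positivity)] at h; linarith
  have hε9 : ε ≤ 1 / 10 ^ 9 := hεle0.trans ((min_le_right _ _).trans ((min_le_right _ _).trans (min_le_right _ _)))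
  have hRb : 2 ^ 15 * ((4 : ℝ) + 1) ^ 2 * ((4 : ℝ) + 4) ^ 2 * ((2 : ℕ) : ℝ) ^ 2 * ε ≤ 1 := by norm_num at hε9 ⊢; linarith
  have hεε₂ : ε ≤ ε₂ := hεle.trans (min_le_left _ _)
  have hε53 : ε ≤ 1 / 10 ^ 53 := hεle.trans ((min_le_right _ _).trans (min_le_left _ _))
  have hεθ : ε ≤ 1 / (1000000000000000000000 * (Fintype.card n : ℝ)) :=
    hεle.trans ((min_le_right _ _).trans ((min_le_right _ _).trans (min_le_left _ _)))
  have hεε₃ : ε ≤ ε₃ := hεle.trans ((min_le_right _ _).trans ((min_le_right _ _).trans ((min_le_right _ _).trans (min_le_left _ _))))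
  have hε1 : ε ≤ 1 := hεle.trans ((min_le_right _ _).trans ((min_le_right _ _).trans ((min_le_right _ _).trans (min_le_right _ _))))
  have hε11 : ε ≤ 1 / 10 ^ 11 := hε53.trans (by norm_num)
  have hθline : 1000000000000000000000 * (Fintype.card n : ℝ) * ε ≤ 1 := by
    rw [le_div_iff₀ hcard] at hεθ; linarith
  -- the strict line: `2κ_c ε < cK`, i.e. the gap `γ := cK/2 − κ_c ε > 0`
  have hsmall : cL * ε ≤ (1 / 2) / Q / 4 := by
    have h1 : cL * ε ≤ cL * ε₃ := mul_le_mul_of_nonneg_left hεε₃ hcL0.le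
    have h2 : cL * ε₃ = (1 / 2) / Q / 4 := by rw [hε₃]; field_simp
    linarith only [h1, h2]
  have hline := line_of_small hQ4 hCS hε hε1 (by rw [← hcL]; exact hsmall)
  obtain ⟨cK, hcK⟩ : ∃ cK : ℝ, cK = ((((1 / 2 - (νc * ε) ^ 2) / Q - (νc * ε) ^ 2) / 2 - 576 * ((4 : ℕ) : ℝ) * ((CS * ε) ^ 2 * Real.exp (2 * (CS * ε)))) / ((2 : ℕ) : ℝ)
      - 28 * ((4 : ℕ) : ℝ) * (ε + 7 * (CS * ε) ^ 2)) := ⟨_, rfl⟩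
  rw [← hcK] at hline
  obtain ⟨γ, hγ⟩ : ∃ γ : ℝ, γ = cK / 2 - κc * ε := ⟨_, rfl⟩
  have hγ0 : 0 < γ := by rw [hγ]; linarith
  -- the constants of the bound
  obtain ⟨C', hC'⟩ : ∃ C' : ℝ, C' = (Real.sqrt (((2 : ℕ) : ℝ) ^ (4 - 2))
            + (Real.sqrt (((2 : ℕ) : ℝ) ^ (4 - 2)) * Real.sqrt (8 * Fintype.card (T4AveragingDeficitWall.Plane 4))
                * (128 * ((4 : ℕ) * ((2 : ℕ) : ℝ) ^ 2))
              + 2 * (2048 * (((4 : ℕ) : ℝ) + 4) ^ 2 * ((2 : ℕ) : ℝ) ^ 2 * Real.sqrt ((4 : ℕ) * ((2 : ℕ) : ℝ) ^ 4))) * b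
            + b ^ 2 * (2 * ((2 : ℕ) : ℝ) ^ (4 - 1) + 2 * (8 * (4 : ℕ) * ((2 : ℕ) : ℝ) ^ 4)) * Real.sqrt ((4 : ℕ) / (g * ((2 : ℕ) : ℝ) ^ (4 + 2)))) := ⟨_, rfl⟩
  have hC'0 : 0 ≤ C' := by rw [hC']; positivity
  obtain ⟨G, hG⟩ : ∃ G : ℝ, G = frameC 4 2 * (CS * ε) := ⟨_, rfl⟩
  have hG0 : 0 ≤ G := by rw [hG]; have := NE7FrameFreeRightInverse.frameC_nonneg 4 2; positivity
  obtain ⟨σ, hσ⟩ : ∃ σ : ℝ, σ = Real.sqrt (4 * (Fintype.card (T4AveragingDeficitWall.Plane 4) : ℝ) + 16) * G := ⟨_, rfl⟩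
  have hσ0 : 0 ≤ σ := by rw [hσ]; positivity
  obtain ⟨w₀, hw₀⟩ : ∃ w₀ : ℝ, w₀ = wallConst 4 2 * dualC2 4 2 * Real.sqrt g := ⟨_, rfl⟩
  have hw₀0 : 0 < w₀ := by rw [hw₀]; exact mul_pos (mul_pos (wallConst_pos 4 2) dualC2_pos_d4) (Real.sqrt_pos.2 hg)
  obtain ⟨Cfin, hCfin⟩ : ∃ Cfin : ℝ, Cfin = C' * (1 + νc * ε) / γ + Real.sqrt (2 * C' * σ / (γ * w₀)) := ⟨_, rfl⟩
  have hCfin0 : 0 ≤ Cfin := by rw [hCfin]; positivity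
  refine ⟨Cfin, CS * ε, hCfin0, by positivity, ?_⟩
  intro N _
  have hN : 1 ≤ N := Nat.one_le_iff_ne_zero.mpr (NeZero.ne N)
  -- the energy budget `γ_E³ = C·ρ₄(N) + 1` (k-free) and the (Gᶜ_w) constant
  obtain ⟨γE, hγEpos, hγE3⟩ := exists_cube_root
    (show 0 < Cfin * (wallConst 4 2 * (N : ℝ) ^ 2 * (Real.sqrt g * dualC2 4 2 + 2 * b ^ 2 * dualC1 4 2)) + 1 by
      have := wallConst_nonneg 4 2; have := dualC1_nonneg 4 2; have := dualC2_nonneg 4 2; positivity)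
  have hD0 : 0 ≤ (1 - θ)⁻¹ := inv_nonneg.mpr (by linarith [NE7EtaClosenessHolder.theta18_lt_one (le_refl 2) hθ18])
  have hcur := curConst_nonneg (d := 4) 2
  refine ⟨4 * (32 * KG * (max γE (max 1 (10 * c + 6 * curConst 4 2 * ε ^ 2 + 8 * (CS * ε) * ε + 4096 * (CS * ε) ^ 2 * ε + 1330 * (CS * ε) ^ 3))) ^ 2 * γE * (1 - θ)⁻¹)
        * ((1 - θ)⁻¹) ^ 2
      + 2 ^ 27 * (CS * ε) ^ 2 * KG ^ 3 * γE ^ 3 * ((1 - θ)⁻¹) ^ 3 + 2 * (KG * cN * γE ^ 6 * (1 - θ)⁻¹ + 2 * cN * γE ^ 6), by positivity, ?_⟩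
  intro dom k hk V _ UA UB hA hB hreg hgA0 hgB0
  obtain ⟨j, rfl⟩ : ∃ j, k = j + 1 := ⟨k - 1, by omega⟩
  -- the dominating letter `c′ := c·(2 + k)` of BOTH minimisers at this level
  set c' : ℝ := c * (2 + ((j + 1 : ℕ) : ℝ)) with hc'
  have hk0 : (0 : ℝ) ≤ ((j + 1 : ℕ) : ℝ) := by positivity
  have hk2 : (1 : ℝ) ≤ 2 + ((j + 1 : ℕ) : ℝ) := by linarith
  have hc'0 : 0 ≤ c' := by rw [hc']; positivity
  have hcc' : c * (1 + ((j + 1 : ℕ) : ℝ)) ≤ c' := by rw [hc']; nlinarith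
  have hgA : ∀ (x : Site 4) (κ : Fin 4) (π : T4AveragingDeficitWall.Plane 4), ‖T4AveragingDeficitWall.covGrad UA (T4AveragingDeficitWall.flux UA) x κ π‖
      ≤ c' / (((2 : ℕ) : ℝ) ^ (j + 1)) ^ 3 := fun x κ π =>
    (hgA0 x κ π).trans (div_le_div_of_nonneg_right hcc' (by positivity))
  have hgB : ∀ (x : Site 4) (κ : Fin 4) (π : T4AveragingDeficitWall.Plane 4), ‖T4AveragingDeficitWall.covGrad UB (T4AveragingDeficitWall.flux UB) x κ π‖
      ≤ c' / (((2 : ℕ) : ℝ) ^ (j + 1 + 1)) ^ 3 := fun x κ π =>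
    (hgB0 x κ π).trans (le_of_eq (by rw [hc']; push_cast; ring))
  have hB' : IsMinimiser 4 (sfClass 4 2 N ε) 2 N (j + 2) V UB := hB
  have hreg' : Regular 4 2 N b g (j + 2) UB := hreg
  -- the competitor `W := cavg 2 U_B` and its class data
  obtain ⟨hbε, hs1, hs2, hWu, hWP, hWx, hWadm⟩ := cavg_admissible_d4 (N := N) j hε hε11 hb hbq hB' hreg'
  have htow : ((tower 2 N (j + 1) : ℕ) : ℤ) = ((N * 2 ^ (j + 1) : ℕ) : ℤ) := by rw [NE3EnergyRateWSupOfSlicePoincare.tower_eq_mul_pow]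
  have hWPt : IsPeriodicCfg (cavg 2 UB) ((tower 2 N (j + 1) : ℕ) : ℤ) := by rw [htow]; exact hWP
  have hM0 : (0 : ℝ) < ((2 : ℕ) : ℝ) ^ (j + 1) := by positivity
  have hM1 : (1 : ℝ) ≤ ((2 : ℕ) : ℝ) ^ (j + 1) := one_le_pow₀ (by norm_num)
  have hx : 0 ≤ ε / (((2 : ℕ) : ℝ) ^ (j + 1)) ^ 2 := by positivity
  -- the pair decomposition in the slice gauge
  obtain ⟨u, X, XT, XN, α, ν, κ, hu, huP, hXs, hXP, hα, hXα, hgauge, hXdec, hXT, hframe, hXN, hν, hNw, hN1, hαM, hνle, hκle, hNs, hNc⟩ :=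
    hdec N ε hε hεε₂ hθline V j (cavg 2 UB) hWadm UA hA.mem
  have hE0 := energyNormW_nonneg 2 (j + 1) (cavg 2 UB) X (periodBox (d := 4) (N * 2 ^ (j + 1)))
  -- (1) the weighted Poincaré letter on the class (constant `8·CPLine ≤ CP`)
  have hP0 := classSlicePoincare_energyBlockLandau_SU2 (n := n) hn hN hε hε53 j (cavg 2 UB) ⟨hWu, hWP, hWx⟩
  have hP := NE3SlicePoincareShape.slicePoincare_mono hP0 (show 8 * CPLine 4 2 2 (1 / 10 ^ 17) (1 / 10 ^ 53) ≤ CP by rw [hCP]; linarith)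
  have hNw2 : energyNormW 2 (j + 1) (cavg 2 UB) XN (periodBox (d := 4) (N * 2 ^ (j + 1))) ^ 2
      ≤ ν ^ 2 * energyNormW 2 (j + 1) (cavg 2 UB) X (periodBox (d := 4) (N * 2 ^ (j + 1))) ^ 2 := by
    have h0 := energyNormW_nonneg 2 (j + 1) (cavg 2 UB) XN (periodBox (d := 4) (N * 2 ^ (j + 1)))
    calc _ ≤ (ν * energyNormW 2 (j + 1) (cavg 2 UB) X (periodBox (d := 4) (N * 2 ^ (j + 1)))) ^ 2 := pow_le_pow_left₀ h0 hNw 2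
      _ = _ := by ring
  have hm := curlSq_ge_weighted (L := 2) (k := j + 1) hCP0 hP hXdec hXT hNw2
  -- (2) the plaquette radius along the segment, (3) the convexity letter
  have h1 : SmallField (vary (cavg 2 UB) X 1) (ε / (((2 : ℕ) : ℝ) ^ (j + 1)) ^ 2) := by
    rw [← hgauge]; exact smallField_gaugeAct hu hA.mem.1.2.2
  have hrad : ∀ t ∈ Icc (0 : ℝ) 1, SmallField (vary (cavg 2 UB) X t) (ε / (((2 : ℕ) : ℝ) ^ (j + 1)) ^ 2 + 7 * α ^ 2) := fun t ht =>
    smallField_vary_segment_class hWu hXs hWx h1 hXα ht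
  have ha' : 0 ≤ ε / (((2 : ℕ) : ℝ) ^ (j + 1)) ^ 2 + 7 * α ^ 2 := by positivity
  have hNM : 1 ≤ N * 2 ^ (j + 1) := Nat.mul_pos (by omega) (Nat.pow_pos (by norm_num))
  have hconv : ∀ t ∈ Icc (0 : ℝ) 1,
      ((((1 / 2 - ν ^ 2) / (2 * (1 + CP)) - ν ^ 2) / 2 - 576 * ((4 : ℕ) : ℝ) * (Real.exp α - 1) ^ 2 * (((2 : ℕ) : ℝ) ^ (j + 1)) ^ 2)
            / (Fintype.card n : ℝ)
          - 28 * ((4 : ℕ) : ℝ) * (ε / (((2 : ℕ) : ℝ) ^ (j + 1)) ^ 2 + 7 * α ^ 2) * (((2 : ℕ) : ℝ) ^ (j + 1)) ^ 2)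
          * energyNormW 2 (j + 1) (cavg 2 UB) X (periodBox (d := 4) (N * 2 ^ (j + 1))) ^ 2
        ≤ hess (vary (cavg 2 UB) X t) X X (perWin 4 (N * 2 ^ (j + 1))) := fun t ht =>
    hess_vary_ge_weighted (d := 4) (L := 2) (k := j + 1) (le_refl 1 |>.trans one_le_two) hNM hWu hXs hXP hα hXα hm ht ha' (hrad t ht)
  -- the k-free minorant `cK ≤ c_k` (card `n = 2`)
  have hck : cK ≤ ((((1 / 2 - ν ^ 2) / (2 * (1 + CP)) - ν ^ 2) / 2 - 576 * ((4 : ℕ) : ℝ) * (Real.exp α - 1) ^ 2 * (((2 : ℕ) : ℝ) ^ (j + 1)) ^ 2)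
            / (Fintype.card n : ℝ)
          - 28 * ((4 : ℕ) : ℝ) * (ε / (((2 : ℕ) : ℝ) ^ (j + 1)) ^ 2 + 7 * α ^ 2) * (((2 : ℕ) : ℝ) ^ (j + 1)) ^ 2) := by
    rw [hn, hcK, hQ]
    exact kfree_coercivity hCP0 hM1 hν hνle hα hαM
  -- (4) Taylor along the segment and (5) minimality of `U_A` against the admissible `W`
  obtain ⟨hd1, hd2⟩ := segment_derivData (cavg 2 UB) X (perWin 4 (N * 2 ^ (j + 1)))
  have htaylor := taylor_lower hd1 hd2 (fun t ht => (mul_le_mul_of_nonneg_right hck (sq_nonneg _)).trans (hconv t ht))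
  rw [T4AveragingDeficitWall.vary_zero] at htaylor
  have hmin : fineAction (vary (cavg 2 UB) X 1) (perWin 4 (N * 2 ^ (j + 1))) ≤ fineAction (cavg 2 UB) (perWin 4 (N * 2 ^ (j + 1))) := by
    have hle := hA.le (cavg 2 UB) hWadm
    rw [← levelAction_gaugeAct 2 N (j + 1) u UA, hgauge] at hle
    unfold levelAction at hle
    have hw : 0 < ((MinimalActionLevels.stepWt 4 2)⁻¹) ^ (j + 1) := pow_pos (inv_pos.mpr (stepWt_pos (d := 4) 2 (by norm_num))) _
    exact le_of_mul_le_mul_left hle hw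
  -- (6) the split of the first variation: the normal part's curl letter
  have hsplit : dAction (cavg 2 UB) X (perWin 4 (N * 2 ^ (j + 1)))
      = dAction (cavg 2 UB) XT (perWin 4 (N * 2 ^ (j + 1))) + dAction (cavg 2 UB) XN (perWin 4 (N * 2 ^ (j + 1))) := by
    conv_lhs => rw [hXdec]
    exact dAction_add _ _ _ _
  have hNpart : |dAction (cavg 2 UB) XN (perWin 4 (N * 2 ^ (j + 1)))| ≤ κ * energyNormW 2 (j + 1) (cavg 2 UB) X (periodBox (d := 4) (N * 2 ^ (j + 1))) ^ 2 :=
    (abs_dAction_le_radius_mul hWu hXN hWx (perWin 4 (N * 2 ^ (j + 1)))).trans hN1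
  -- (7)–(8) (RES♯) on the slice part, with the spike's weighted energy
  have hres := abs_dAction_le_of_regular_slice (n := n) (d := 4) (by norm_num) (le_refl 1 |>.trans one_le_two) hN j hb hbε hg hs2 hB' hreg'
    hWu hWPt hx hs1 hWx hXT
  obtain ⟨-, -, -, hfP, -⟩ := spike_tangent_data (N := N) (le_refl 1 |>.trans one_le_two) j hWu hWPt hx hs1 hWx hXT
  have hS2 := energyNormW_spike_sq_le (d := 4) (le_refl 1 |>.trans one_le_two) hN j hWu hWx hfP hframe
  have hES0 := energyNormW_nonneg 2 (j + 1) (cavg 2 UB) (gaugeDir (cavg 2 UB) (spikeW (2 ^ (j + 1)) (framePotW 2 (j + 1) (cavg 2 UB) XT)))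
      (periodBox (d := 4) (N * 2 ^ (j + 1)))
  have hET := energyNormW_sub_le 2 (j + 1) (cavg 2 UB) X XN (periodBox (d := 4) (N * 2 ^ (j + 1)))
  have hXTeq : XT = X - XN := eq_sub_of_add_eq hXdec.symm
  rw [← hXTeq] at hET
  have hρlow := residualScale_lower_d4 N j (b := b) hg.le
  have hρ0 := residualScale_nonneg 4 2 N b g (j + 1)
  -- ABSTRACT THE ATOMS and do the arithmetic with the pure real lemmas of §3b
  set M : ℝ := ((2 : ℕ) : ℝ) ^ (j + 1) with hM
  set E : ℝ := energyNormW 2 (j + 1) (cavg 2 UB) X (periodBox (d := 4) (N * 2 ^ (j + 1))) with hE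
  set ET : ℝ := energyNormW 2 (j + 1) (cavg 2 UB) XT (periodBox (d := 4) (N * 2 ^ (j + 1))) with hETdef
  set EN : ℝ := energyNormW 2 (j + 1) (cavg 2 UB) XN (periodBox (d := 4) (N * 2 ^ (j + 1))) with hENdef
  set ES : ℝ := energyNormW 2 (j + 1) (cavg 2 UB) (gaugeDir (cavg 2 UB) (spikeW (2 ^ (j + 1)) (framePotW 2 (j + 1) (cavg 2 UB) XT)))
      (periodBox (d := 4) (N * 2 ^ (j + 1))) with hESdef
  set ρ : ℝ := residualScale 4 2 N b g (j + 1) with hρ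
  set P : ℝ := (Fintype.card (T4AveragingDeficitWall.Plane 4) : ℝ) with hPdef
  have hP0' : 0 ≤ P := by rw [hPdef]; positivity
  -- `hres` in the abstract currency: `|dAction W X_T| ≤ C'ρ (ET + ES)`
  have hres' : |dAction (cavg 2 UB) XT (perWin 4 (N * 2 ^ (j + 1)))| ≤ C' * ρ * (ET + ES) := by rw [hC']; exact hres
  have hr0 : 0 ≤ C' * ρ := mul_nonneg hC'0 hρ0
  -- the spike's weighted energy: `ES ≤ σ·N²/M`
  have hESle : ES ≤ σ * ((N : ℝ) ^ 2 / M) := by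
    have h := spike_energy_le hES0 hG0 hM0 hP0' (by rw [hG]; exact hS2)
      (spike_coef_le hM1 hε.le hε1 hP0')
    rw [hσ, hPdef]; simpa only [mul_assoc] using h
  -- (9) the two-sided inequality `γ E² ≤ C'ρ(1+ν_c ε)·E + C'ρ·σ·N²/M`
  have hkey : dAction (cavg 2 UB) X (perWin 4 (N * 2 ^ (j + 1))) + cK * E ^ 2 / 2 ≤ 0 := by linarith only [htaylor, hmin]
  have hETle : ET ≤ (1 + νc * ε) * E := by
    have : EN ≤ νc * ε * E := hNw.trans (mul_le_mul_of_nonneg_right hνle hE0)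
    linarith only [hET, this]
  have hTpart : |dAction (cavg 2 UB) XT (perWin 4 (N * 2 ^ (j + 1)))| ≤ C' * ρ * ((1 + νc * ε) * E + σ * ((N : ℝ) ^ 2 / M)) :=
    hres'.trans (mul_le_mul_of_nonneg_left (by linarith only [hETle, hESle]) hr0)
  have hγE : γ * E ^ 2 ≤ C' * ρ * (1 + νc * ε) * E + C' * ρ * (σ * ((N : ℝ) ^ 2 / M)) := by
    rw [hγ]; exact two_sided_ineq hkey hsplit hNpart hTpart hκle
  -- (10) `N²/M ≤ 2ρ/w₀` and the final bookkeeping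
  have hNM' : (N : ℝ) ^ 2 / M ≤ 2 * ρ / w₀ := ratio_le_of_lower hM0 hw₀0 (by rw [hw₀]; exact hρlow)
  have hfinal : E ≤ Cfin * ρ := by
    rw [hCfin]
    exact rate_algebra hρ0 hγ0 hC'0 (by positivity) hσ0 hw₀0 (by positivity) hNM' hγE
  -- (11) the sup letter: `‖X(b)‖ ≤ α ≤ C_S ε / M = (C_S ε)·2^{−(j+1)}`
  have hsup : ∀ (x : Site 4) (κ' : Fin 4), ‖X x κ'‖ ≤ CS * ε * (((2 : ℕ) : ℝ)⁻¹) ^ (j + 1) := by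
    intro x κ'
    have hαle : α ≤ CS * ε / M := by rw [le_div_iff₀ hM0]; exact hαM
    have e : CS * ε * (((2 : ℕ) : ℝ)⁻¹) ^ (j + 1) = CS * ε / M := by rw [inv_pow, hM]; ring
    rw [e]; exact (hXα x κ').trans hαle
  -- (12) THE COVARIANT-GRADIENT RATE (Gᶜ_w): budget form of (E), the radii of the pair, and `covGrad_rate`
  have hEγ : ((2 : ℕ) : ℝ) ^ (j + 1) * E ≤ γE ^ 3 := by
    have h := energy_budget_of_residualScale (L := 2) (le_refl 1 |>.trans one_le_two) N b hg.le hCfin0 (j + 1) hfinal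
    rw [hγE3]; linarith
  -- the plaquette-gradient radius of `W = cavg U_B` from the flux-gradient letter of `U_B` (level `j+2`)
  have hregB : RegularSup 4 2 N ε c' (j + 2) UB := ⟨hB.mem.1.1, hB.mem.1.2.1, hB.mem.1.2.2, hgB⟩
  have hx₁W : ∀ (p : Site 4) (lam μ' ν' : Fin 4), μ' ≠ ν' →
      ‖T4AveragingDeficitWall.Ad (cavg 2 UB p lam) ((hol (cavg 2 UB) (p + e lam) (plaqWord μ' ν') : (Matrix n n ℂ)ˣ) : Matrix n n ℂ)
          - ((hol (cavg 2 UB) p (plaqWord μ' ν') : (Matrix n n ℂ)ˣ) : Matrix n n ℂ)‖ ≤ 2 * (c' + curConst 4 2 * ε ^ 2) / (((2 : ℕ) : ℝ) ^ (j + 1)) ^ 3 :=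
    fun p lam μ' ν' hne => norm_plaqGrad_cavg_le_of_regularSup (d := 4) (le_refl 1 |>.trans one_le_two) hregB hε.le (by push_cast; exact hRb) p lam hne
  -- the plaquette-gradient radius of `U_A^{u} = W e^{X}` from the flux-gradient letter of `U_A` (gauge covariance)
  have hx₁U : ∀ (p : Site 4) (lam μ' ν' : Fin 4), μ' ≠ ν' →
      ‖T4AveragingDeficitWall.Ad (vary (cavg 2 UB) X 1 p lam) ((hol (vary (cavg 2 UB) X 1) (p + e lam) (plaqWord μ' ν') : (Matrix n n ℂ)ˣ) : Matrix n n ℂ)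
          - ((hol (vary (cavg 2 UB) X 1) p (plaqWord μ' ν') : (Matrix n n ℂ)ˣ) : Matrix n n ℂ)‖ ≤ 2 * c' / (((2 : ℕ) : ℝ) ^ (j + 1)) ^ 3 := by
    intro p lam μ' ν' hne
    rw [← hgauge, norm_plaqGrad_gaugeAct' hu p lam μ' ν']
    have ha : ε / (((2 : ℕ) : ℝ) ^ (j + 1)) ^ 2 ≤ 1 / 4 := (div_le_self hε.le (one_le_pow₀ hM1)).trans (by linarith)
    have h := norm_Ad_hol_sub_hol_le_of_fluxGrad hA.mem.1.1 hA.mem.1.2.2 ha hgA p lam hne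
    exact h.trans (le_of_eq (by ring))
  have hG := hcov 40 (by norm_num) N j ε (CS * ε) c' cN hε hεεG (by positivity) hε48 hc'0 hcN (cavg 2 UB) hWu hWP hWx hs1 X XT XN hXs hXP hXdec hXT α hXα hαM h1
    γE hγEpos hEγ hNs hNc hx₁W hx₁U θ hθ hθ18
  refine ⟨u, X, hu, huP, hXs, hXP, hgauge, hfinal, hsup, fun κ' x' μ' => (hG κ' x' μ').trans ?_⟩
  -- the letter's `(2+k)²` against `θ^{2k}`: `Λ₂⁰(c′) ≤ (2+k)Λ₂⁰(c)`, `l₀(c′) ≤ (2+k)l₀(c)`, `(2+k)²θ^{40k} ≤ 4D²θ^{38k}`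
  have hθ1 : θ < 1 := NE7EtaClosenessHolder.theta18_lt_one (le_refl 2) hθ18
  set Λc : ℝ := 10 * c + 6 * curConst 4 2 * ε ^ 2 + 8 * (CS * ε) * ε + 4096 * (CS * ε) ^ 2 * ε + 1330 * (CS * ε) ^ 3 with hΛc
  have hrest : 0 ≤ 6 * curConst 4 2 * ε ^ 2 + 8 * (CS * ε) * ε + 4096 * (CS * ε) ^ 2 * ε + 1330 * (CS * ε) ^ 3 := by positivity
  have hΛc' : 10 * c' + 6 * curConst 4 2 * ε ^ 2 + 8 * (CS * ε) * ε + 4096 * (CS * ε) ^ 2 * ε + 1330 * (CS * ε) ^ 3 ≤ (2 + ((j + 1 : ℕ) : ℝ)) * Λc := by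
    have hr := mul_le_mul_of_nonneg_right hk2 hrest
    rw [one_mul] at hr
    have e : (2 + ((j + 1 : ℕ) : ℝ)) * Λc = 10 * c' + (2 + ((j + 1 : ℕ) : ℝ)) * (6 * curConst 4 2 * ε ^ 2 + 8 * (CS * ε) * ε + 4096 * (CS * ε) ^ 2 * ε + 1330 * (CS * ε) ^ 3) := by
      rw [hΛc, hc']; ring
    rw [e]; linarith
  set l₀ : ℝ := max γE (max 1 Λc) with hl₀
  have hl₀0 : 0 < l₀ := lt_of_lt_of_le hγEpos (le_max_left _ _)
  have hmax : max γE (max 1 (10 * c' + 6 * curConst 4 2 * ε ^ 2 + 8 * (CS * ε) * ε + 4096 * (CS * ε) ^ 2 * ε + 1330 * (CS * ε) ^ 3)) ≤ (2 + ((j + 1 : ℕ) : ℝ)) * l₀ := by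
    refine max_le ?_ (max_le ?_ ?_)
    · calc γE = 1 * γE := (one_mul _).symm
        _ ≤ (2 + ((j + 1 : ℕ) : ℝ)) * l₀ := mul_le_mul hk2 (le_max_left _ _) hγEpos.le (by linarith)
    · calc (1 : ℝ) = 1 * 1 := (one_mul _).symm
        _ ≤ (2 + ((j + 1 : ℕ) : ℝ)) * l₀ := mul_le_mul hk2 ((le_max_left _ _).trans (le_max_right _ _)) zero_le_one (by linarith)
    · exact hΛc'.trans (mul_le_mul_of_nonneg_left ((le_max_right _ _).trans (le_max_right _ _)) (by linarith))
  have hmax0 : 0 ≤ max γE (max 1 (10 * c' + 6 * curConst 4 2 * ε ^ 2 + 8 * (CS * ε) * ε + 4096 * (CS * ε) ^ 2 * ε + 1330 * (CS * ε) ^ 3)) :=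
    hγEpos.le.trans (le_max_left _ _)
  have hsq : (max γE (max 1 (10 * c' + 6 * curConst 4 2 * ε ^ 2 + 8 * (CS * ε) * ε + 4096 * (CS * ε) ^ 2 * ε + 1330 * (CS * ε) ^ 3))) ^ 2
      ≤ (2 + ((j + 1 : ℕ) : ℝ)) ^ 2 * l₀ ^ 2 := by
    rw [← mul_pow]; exact pow_le_pow_left₀ hmax0 hmax 2
  have hθ40 : 0 ≤ θ ^ (40 * (j + 1)) := pow_nonneg hθ.le _
  -- term 1
  have t1 : 32 * KG * (max γE (max 1 (10 * c' + 6 * curConst 4 2 * ε ^ 2 + 8 * (CS * ε) * ε + 4096 * (CS * ε) ^ 2 * ε + 1330 * (CS * ε) ^ 3))) ^ 2 * γE * (1 - θ)⁻¹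
        * θ ^ (40 * (j + 1))
      ≤ 4 * (32 * KG * l₀ ^ 2 * γE * (1 - θ)⁻¹) * ((1 - θ)⁻¹) ^ 2 * θ ^ (38 * (j + 1)) := by
    have h1 : 32 * KG * (max γE (max 1 (10 * c' + 6 * curConst 4 2 * ε ^ 2 + 8 * (CS * ε) * ε + 4096 * (CS * ε) ^ 2 * ε + 1330 * (CS * ε) ^ 3))) ^ 2 * γE * (1 - θ)⁻¹
          * θ ^ (40 * (j + 1))
        ≤ (32 * KG * l₀ ^ 2 * γE * (1 - θ)⁻¹) * (2 + ((j + 1 : ℕ) : ℝ)) ^ 2 * θ ^ (40 * (j + 1)) := by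
      have := mul_le_mul_of_nonneg_left hsq (show 0 ≤ 32 * KG * γE * (1 - θ)⁻¹ by positivity)
      have e1 : 32 * KG * (max γE (max 1 (10 * c' + 6 * curConst 4 2 * ε ^ 2 + 8 * (CS * ε) * ε + 4096 * (CS * ε) ^ 2 * ε + 1330 * (CS * ε) ^ 3))) ^ 2 * γE * (1 - θ)⁻¹
          = 32 * KG * γE * (1 - θ)⁻¹ * (max γE (max 1 (10 * c' + 6 * curConst 4 2 * ε ^ 2 + 8 * (CS * ε) * ε + 4096 * (CS * ε) ^ 2 * ε + 1330 * (CS * ε) ^ 3))) ^ 2 := by ring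
      have e2 : (32 * KG * l₀ ^ 2 * γE * (1 - θ)⁻¹) * (2 + ((j + 1 : ℕ) : ℝ)) ^ 2 = 32 * KG * γE * (1 - θ)⁻¹ * ((2 + ((j + 1 : ℕ) : ℝ)) ^ 2 * l₀ ^ 2) := by ring
      rw [e1, e2]; exact mul_le_mul_of_nonneg_right this hθ40
    exact h1.trans (sq_two_add_rate hθ.le hθ1 (by positivity) (j + 1))
  -- terms 2 and 3 lose `θ^{2k} ≤ 1`
  have t2 := rate_plain (A := 2 ^ 27 * (CS * ε) ^ 2 * KG ^ 3 * γE ^ 3 * ((1 - θ)⁻¹) ^ 3) hθ.le hθ1.le (by positivity) (show 38 ≤ 40 by norm_num) (j + 1)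
  have t3 := rate_plain (A := 2 * (KG * cN * γE ^ 6 * (1 - θ)⁻¹ + 2 * cN * γE ^ 6)) hθ.le hθ1.le (by positivity) (show 38 ≤ 40 by norm_num) (j + 1)
  have e : (32 * KG * (max γE (max 1 (10 * c' + 6 * curConst 4 2 * ε ^ 2 + 8 * (CS * ε) * ε + 4096 * (CS * ε) ^ 2 * ε + 1330 * (CS * ε) ^ 3))) ^ 2 * γE * (1 - θ)⁻¹
        + 2 ^ 27 * (CS * ε) ^ 2 * KG ^ 3 * γE ^ 3 * ((1 - θ)⁻¹) ^ 3 + 2 * (KG * cN * γE ^ 6 * (1 - θ)⁻¹ + 2 * cN * γE ^ 6)) * θ ^ (40 * (j + 1))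
      = 32 * KG * (max γE (max 1 (10 * c' + 6 * curConst 4 2 * ε ^ 2 + 8 * (CS * ε) * ε + 4096 * (CS * ε) ^ 2 * ε + 1330 * (CS * ε) ^ 3))) ^ 2 * γE * (1 - θ)⁻¹
          * θ ^ (40 * (j + 1))
        + 2 ^ 27 * (CS * ε) ^ 2 * KG ^ 3 * γE ^ 3 * ((1 - θ)⁻¹) ^ 3 * θ ^ (40 * (j + 1))
        + 2 * (KG * cN * γE ^ 6 * (1 - θ)⁻¹ + 2 * cN * γE ^ 6) * θ ^ (40 * (j + 1)) := by ring
  rw [e]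
  have e' : (4 * (32 * KG * l₀ ^ 2 * γE * (1 - θ)⁻¹) * ((1 - θ)⁻¹) ^ 2 + 2 ^ 27 * (CS * ε) ^ 2 * KG ^ 3 * γE ^ 3 * ((1 - θ)⁻¹) ^ 3
        + 2 * (KG * cN * γE ^ 6 * (1 - θ)⁻¹ + 2 * cN * γE ^ 6)) * θ ^ (38 * (j + 1))
      = 4 * (32 * KG * l₀ ^ 2 * γE * (1 - θ)⁻¹) * ((1 - θ)⁻¹) ^ 2 * θ ^ (38 * (j + 1))
        + 2 ^ 27 * (CS * ε) ^ 2 * KG ^ 3 * γE ^ 3 * ((1 - θ)⁻¹) ^ 3 * θ ^ (38 * (j + 1))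
        + 2 * (KG * cN * γE ^ 6 * (1 - θ)⁻¹ + 2 * cN * γE ^ 6) * θ ^ (38 * (j + 1)) := by ring
  rw [e']
  linarith

end

end Summit.QuantumFields.BalabanUV.T4Continuum.NE7EnergyGradRateWSU2Log
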